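import Summits.ABC.ABC.Theses.TwistAmplification
import Literature.NumberTheory.EllipticCurves.QuadraticTwistIntegralModel
import Literature.NumberTheory.EllipticCurves.QuadraticTwistMinimalModelProofs
import Literature.NumberTheory.EllipticCurves.SzpiroLocalDataProofs
import Literature.NumberTheory.EllipticCurves.RootNumberSmulProofs
import Literature.NumberTheory.DiophantineGeometry.ConductorExponentZeroProofs
import Literature.NumberTheory.DiophantineGeometry.ConductorMultiplicativeProofs
import Literature.NumberTheory.DiophantineGeometry.ConductorFactorizationProofs

/-!
# Stub `stub_twistConductorDvd` (T1) of line `polynomial-degree-suffices`,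
# crux `TwistAmplification.SomeWindowSaving` (stmt-ABC-1976)

For an elliptic `E = W₀ ⊗ ℚ`, an integer `d ≡ 1 (mod 4)` with `d² ∣ N(E)` and the quadratic twist
`E^{(d)} := E.quadraticTwist d` semistable, the conductor of the twist divides that of `E`:
`N(E^{(d)}) ∣ N(E)`.

Proof, prime by prime (`N = ∏_p p^{f_p}`, `conductorNorm_dvd_of_forall_conductorExponent_le`,
`factorization_conductorNorm_primesEquiv_symm`). Write `d = 4k + 1`; over `ℚ` the quadratic twist
is isomorphic to the integral twist model, `E^{(d)} = C • E.twistModel k`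
(`exists_variableChange_twistModel_eq_quadraticTwist`), and `f_p` is an isomorphism invariant
(`conductorExponent_smul'`).
* At `p ∤ d` the twist is unramified (`|k|_p ≤ 1`, `|4k+1|_p = 1`), so
  `f_p(E.twistModel k) = f_p(E)` (`conductorExponent_twistModel`).
* At `p ∣ d`, semistability of the twist gives `f_p(E^{(d)}) ≤ 1`
  (`conductorExponent_eq_zero_iff_holds`, `conductorExponent_eq_one_iff_holds`), while
  `d.natAbs² ∣ N(E)` gives `2 ≤ ord_p N(E)`.
-/

-- `Summit.<Summit>.<Problem>` is the mandated summit-side namespace (CONVENTIONS §2); for the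
-- single-conjunct summit `ABC` the two coincide, so the duplicate `ABC.ABC` is deliberate.
set_option linter.dupNamespace false

namespace Summit.ABC.ABC.Theorems

open WeierstrassCurve IsDedekindDomain

namespace TwistConductorDvd

/-- `d ≡ 1 (mod 4)` unfolds to `d = 4k + 1` for some integer `k`. [folklore] -/
theorem exists_eq_four_mul_add_one {d : ℤ} (hd : d ≡ 1 [ZMOD 4]) : ∃ k : ℤ, d = 4 * k + 1 := by
  obtain ⟨c, hc⟩ := Int.modEq_iff_dvd.mp hd.symm
  exact ⟨c, by omega⟩

/-- An integer is `v`-integral at every finite place `v` of `ℤ`: `|k|_v ≤ 1`. [folklore] -/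
theorem valuation_intCast_le_one (v : HeightOneSpectrum ℤ) (k : ℤ) :
    v.valuation ℚ (k : ℚ) ≤ 1 := by
  rw [show (k : ℚ) = algebraMap ℤ ℚ k from (eq_intCast _ k).symm]
  exact HeightOneSpectrum.valuation_le_one v k

/-- At the place above a prime `p ∤ 4k + 1` the twisting parameter `4k + 1` is a `p`-adic unit:
`|4k + 1|_p = 1`. [folklore] -/
theorem valuation_four_mul_add_one_eq_one (p : Nat.Primes) (k : ℤ)
    (h : ¬ ((p : ℕ) : ℤ) ∣ 4 * k + 1) :
    ((Rat.HeightOneSpectrum.primesEquiv (R := ℤ)).symm p).valuation ℚ (4 * (k : ℚ) + 1) = 1 := by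
  rw [show (4 * (k : ℚ) + 1 : ℚ) = ((4 * k + 1 : ℤ) : ℚ) by push_cast; ring,
    Literature.NumberTheory.EllipticCurves.Rat.valuation_intCast_eq_one_iff,
    Literature.NumberTheory.EllipticCurves.Rat.natGenerator_primesEquiv_symm]
  exact h

/-- At a semistable place of an elliptic curve over `ℚ` the conductor exponent is at most `1`
(`f_v = 0` for good reduction, `f_v = 1` for multiplicative reduction; Silverman ATAEC IV.10.2).
[folklore] -/
theorem conductorExponent_le_one_of_isSemistableAt (W : WeierstrassCurve ℚ) [W.IsElliptic]
    (v : HeightOneSpectrum ℤ) (h : W.IsSemistableAt v) : W.conductorExponent v ≤ 1 := by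
  rcases h with hg | hm
  · rw [(conductorExponent_eq_zero_iff_holds v W).mpr hg]
    exact Nat.zero_le 1
  · rw [(conductorExponent_eq_one_iff_holds v W).mpr hm]

/-- `p ∣ d` and `d.natAbs ^ 2 ∣ N` with `N ≠ 0` give `2 ≤ ord_p N`. [folklore] -/
theorem two_le_factorization_of_sq_dvd (p : Nat.Primes) {d : ℤ} {N : ℕ} (hN : N ≠ 0)
    (hpd : ((p : ℕ) : ℤ) ∣ d) (hdvd : d.natAbs ^ 2 ∣ N) : 2 ≤ N.factorization p := by
  have hp2 : (p : ℕ) ^ 2 ∣ N := dvd_trans (pow_dvd_pow_of_dvd (Int.natCast_dvd.mp hpd) 2) hdvd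
  exact (p.2.pow_dvd_iff_le_factorization hN).mp hp2

/-- The twist model `W.twistModel k` of an elliptic curve by a non-zero `d = 4k + 1` is elliptic
(`Δ ↦ d⁶ Δ`, `twistModel_Δ`; Silverman AEC X.5 Cor. 5.4). [folklore] -/
theorem isElliptic_twistModel (W : WeierstrassCurve ℚ) [W.IsElliptic] (k : ℚ)
    (hd : 4 * k + 1 ≠ 0) : (W.twistModel k).IsElliptic := by
  refine ⟨?_⟩
  rw [twistModel_Δ]
  exact (IsUnit.mk0 _ (pow_ne_zero 6 hd)).mul W.isUnit_Δ

/-- The conductor exponent of the quadratic twist `W^{(4k+1)}` equals that of the integral twist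
model `W.twistModel k`: the two equations are `ℚ`-isomorphic
(`exists_variableChange_twistModel_eq_quadraticTwist`) and `f_v` is an isomorphism invariant of an
elliptic curve (`conductorExponent_smul'`; Silverman AEC C.16). [folklore] -/
theorem conductorExponent_quadraticTwist_eq_twistModel (W : WeierstrassCurve ℚ) [W.IsElliptic]
    (k : ℚ) (hd : 4 * k + 1 ≠ 0) (v : HeightOneSpectrum ℤ) :
    (W.quadraticTwist (4 * k + 1)).conductorExponent v = (W.twistModel k).conductorExponent v := by
  obtain ⟨C, -, hC⟩ := exists_variableChange_twistModel_eq_quadraticTwist W k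
  haveI := isElliptic_twistModel W k hd
  rw [← hC, conductorExponent_smul']

end TwistConductorDvd

open TwistConductorDvd in
/-- **Stub T1 (`TwistConductorDvd`).** For an elliptic `E = W₀ ⊗ ℚ`, an integer `d ≡ 1 (mod 4)`
with `d.natAbs ^ 2 ∣ N(E)` and the quadratic twist `E^{(d)} = E.quadraticTwist d` semistable,
`N(E^{(d)}) ∣ N(E)`. Prime by prime: at `p ∤ d` the conductor exponents of
`E^{(d)} ≅ E.twistModel k` (`d = 4k + 1`) and `E` agree (unramified twist,
`conductorExponent_twistModel`); at `p ∣ d` the twist is semistable, so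
`f_p(E^{(d)}) ≤ 1 < 2 ≤ ord_p N(E)`. (Connell, *Elliptic Curve Handbook* §4.3; Comalada 1994 §2;
Silverman ATAEC IV.10.2.) [folklore] -/
theorem stub_twistConductorDvd :
    ∀ (W₀ : WeierstrassCurve ℤ), (W₀.baseChange ℚ).IsElliptic →
      ∀ d : ℤ, d ≡ 1 [ZMOD 4] → d.natAbs ^ 2 ∣ (W₀.baseChange ℚ).conductorNorm ℤ →
        ((W₀.baseChange ℚ).quadraticTwist (d : ℚ)).IsSemistable ℤ →
          ((W₀.baseChange ℚ).quadraticTwist (d : ℚ)).conductorNorm ℤ ∣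
            (W₀.baseChange ℚ).conductorNorm ℤ := by
  intro W₀ hE d hd4 hdvd hss
  obtain ⟨k, rfl⟩ := exists_eq_four_mul_add_one hd4
  have hd0 : ((4 * k + 1 : ℤ) : ℚ) ≠ 0 := by
    have : (4 * k + 1 : ℤ) ≠ 0 := by omega
    exact_mod_cast this
  haveI : ((W₀.baseChange ℚ).quadraticTwist ((4 * k + 1 : ℤ) : ℚ)).IsElliptic :=
    isElliptic_quadraticTwist _ hd0
  have hN0 : (W₀.baseChange ℚ).conductorNorm ℤ ≠ 0 := (conductorNorm_pos_holds _).ne'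
  refine conductorNorm_dvd_of_forall_conductorExponent_le _ hN0 fun p ↦ ?_
  by_cases hpd : ((p : ℕ) : ℤ) ∣ 4 * k + 1
  · have h1 := conductorExponent_le_one_of_isSemistableAt _
      ((Rat.HeightOneSpectrum.primesEquiv (R := ℤ)).symm p) (hss _)
    have h2 := two_le_factorization_of_sq_dvd p hN0 hpd hdvd
    omega
  · have hcast : ((4 * k + 1 : ℤ) : ℚ) = 4 * (k : ℚ) + 1 := by push_cast; ring
    have hd0' : 4 * (k : ℚ) + 1 ≠ 0 := hcast ▸ hd0
    rw [hcast, conductorExponent_quadraticTwist_eq_twistModel _ _ hd0',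
      conductorExponent_twistModel ((Rat.HeightOneSpectrum.primesEquiv (R := ℤ)).symm p)
        (W₀.baseChange ℚ) (valuation_intCast_le_one _ k)
        (valuation_four_mul_add_one_eq_one p k hpd),
      factorization_conductorNorm_primesEquiv_symm]

end Summit.ABC.ABC.Theorems
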